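import Summits.BirchSwinnertonDyer.BirchSwinnertonDyer.Theorems.RamifiedHeegnerPairRamifiedPairLowerBoundOfLowerHalfOverK
import Literature.NumberTheory.EllipticCurves.Rank1Residual.Typed.Basic
import Literature.NumberTheory.EllipticCurves.QuadraticTwist
import Literature.NumberTheory.EllipticCurves.ComplexMultiplicationHasCMProofs
import HarnessLib

/-!
# Route `RamifiedHeegnerPair`, crux X2 `RamifiedPairUpperBound` (stmt-BirchSwinnertonDyer-23192), line `birth` —
# the crux BY NAME (i) from the displayed published inputs and ONE statement over the 3-ramified field:
# the UPPER (Euler-system) half of `BSD₃` for `E` over `K = ℚ(√d)`; (ii) from the two members' upper halves over `ℚ`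

HONEST FRAMING. Theorems only; helper file (`--supports stmt-BirchSwinnertonDyer-23192`). The crux
`RamifiedPairUpperBound` (the UPPER half of `BSD₃` for the 3-ramified twist pair `(E, E^{(d)})` on the
W-ALL leaf Gss2 at `3`: `ord₃ #Ш(E) + ord₃ #Ш(E^{(d)}) ≤ ord₃ #Ш_an(E) + ord₃ #Ш_an(E^{(d)})`) is NOT
proved here and BSD is not proved by any of this. This is the X2 twin of the X1 file
`RamifiedHeegnerPairRamifiedPairLowerBoundOfLowerHalfOverK.lean` (prover bsd-line-rhp-p1), whose
bookkeeping it reuses verbatim; what it proves is the kernel-checked REDUCTION of X2 along its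
registered line `birth` (skeleton v3: stubs = the published inputs + `stub_upperHalfOverK`):

(i) `ramifiedPairUpperBound_of_upperHalfOverK`. GIVEN the route's displayed published inputs —
Gross–Zagier–Kolyvagin (`rank_eq_analyticRank_of_analyticRank_le_one`, the route's `PublishedInputGZK`),
modularity (`hasEntireLFunction_rat`, `nonempty_modularParametrizationData`), Gross–Zagier 1986
Thm. I.(7.3) (`GrossZagier1986_thm_I_7_3`) and Milne 1972 Thm. 1 in Dokchitser–Dokchitser's model-free
form (`Milne1972.bsdQuotient_baseChange_quadratic_anyModel`) — the crux follows from ONE statement over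
the imaginary quadratic field `K = ℚ(√d)` in which `3` ramifies:

  `UpperHalfOverK`: for `(W, V, d)` as in the crux and `K = ℚ(θ)`, `θ² = d`, `[K : ℚ] = 2`, with `Ш(W_K)`
  finite: `#Ш_an(W_K/K)` (the tree's `analyticSha (W.baseChange K)`; definitionally the cell predicate
  `AdditivePotMult.MissingUpperBoundOverCAt (W.baseChange K) 3`) is a rational `q` with
  `ord₃ #Ш(W_K/K) ≤ ord₃ q`

— the `ℚ`-to-`K` shadow named in the route thesis for X2 (Kolyvagin's Euler system of CM points on the
Cai–Shu–Tian Shimura curve `X_U` at joint ramification `9 ∣ N`, `3 ∣ d_K`, made `3`-exact, for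
`A = E/K` good supersingular at the RAMIFIED prime above `3` with `r_an(A/K) = 1`; Nekovář 2007 Thm. 3.2
is the non-exact form; NOT in print in the exact form, NOT proved here). It is displayed as the explicit
hypothesis `hKU`, written as a closed term in tree vocabulary so that the planner can file it verbatim.

(i′) `upperHalfOverK_of_ramifiedPairUpperBound` — the CONVERSE: given `hGZK`, `hE`, `hMilne`, the crux
IMPLIES «UpperHalfOverK» (rationality of `#Ш_an(W_K)` transported up by
`AdditivePotMult.exists_shaAnOverC_eq_of_rat`), so the line's load-bearing stub is EQUIVALENT to X2 modulo
the displayed published inputs — the reshape is lossless (X1 twin: `lowerHalfOverK_of_ramifiedPairLowerBound`).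

(ii) `ramifiedPairUpperBound_of_missingUpperBoundAt`. Pure bookkeeping, no published input: X2 also
follows from the two MEMBERS' upper halves over `ℚ` in Miller's currency (`Typed.MissingUpperBoundAt · 3`):
the upper half of `BSD₃` on the Gss2 leaf itself (non-CM, additive (G) ∧ ss at `3`, `r_an ≤ 1`) and the
upper half of `BSD₃` for non-CM curves GOOD supersingular at `3` with `r_an ≤ 1` (the Euler-system half
of the route's residual `GoodSupersingularAtThree`). Non-CM passes to the twist through `j`
(`j_quadraticTwist`, `hasCM_iff_of_j_eq`). This records that X2 asks for no less than the members'
Euler-system halves in one of the two rank orientations — the pair form only relocates them to `K`.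

THE BOOKKEEPING of (i) (all tree theorems, as in the X1 file): `K = ℚ(√d)` exists
(`SolventPairLowerBound.exists_quadraticField_sq_eq_intCast`; `d` is no square since `ord₃ d = 1`); a model
of `W^{(d)}` is a model of `W^{(d_K)}` (`SolventPairLowerBound.exists_variableChange_quadraticTwist_discr`);
`Ш(W)`, `Ш(V)` finite (GZK, `r_an ≤ 1` each); Milne's identity gives `Ш(W_K)` finite and the
Weil-restriction equation `hWR`; Artin formalism and `hWR` give
`(★)` `#Ш_an(W_K)·#Ш(W)·#Ш(V) = #Ш_an(W)·#Ш_an(V)·#Ш(W_K)` (`AdditivePotMult.shaAnOverC_mul_eq`);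
`#Ш_an(W)`, `#Ш_an(V)` are non-zero rationals (`RamifiedPairLowerBound.exists_rat_shaAn_eq_of_analyticRank_le_one`,
`AdditivePotMult.shaAn_ne_zero`); `ord₃` of `(★)` and the over-`K` inequality give the crux's inequality
(`padicValRat_natCast_add_le_of_mul_eq`).

Lead prover bsd-line-rhp-p2 g0, 2026-08-28. References: J. S. Milne, Invent. Math. 17 (1972) Thm. 1;
T. Dokchitser, V. Dokchitser, Ann. of Math. 172 (2010) §2.1; B. Gross, D. Zagier, Invent. Math. 84 (1986)
Thm. I.(7.3); V. A. Kolyvagin, *Euler systems* (1990); J. Nekovář, *The Euler system method for CM points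
on Shimura curves* (2007) Thm. 3.2; L. Cai, J. Shu, Y. Tian, Algebra Number Theory 8 (2014) Thm. 1.5;
R. L. Miller, LMS J. Comput. Math. 14 (2011) §1.
-/

-- D-0017: single-problem summit, so `Summit.BirchSwinnertonDyer.BirchSwinnertonDyer.…` repeats a namespace BY DESIGN.
set_option linter.dupNamespace false
set_option autoImplicit false

noncomputable section

open scoped Classical

open WeierstrassCurve Literature.NumberTheory.EllipticCurves
  Literature.NumberTheory.EllipticCurves.ModularForms Literature.NumberTheory.EllipticCurves.Rank1Residual

namespace Summit.BirchSwinnertonDyer.BirchSwinnertonDyer.Theorems.RamifiedPairUpperBound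

/-! ## Valuation bookkeeping -/

/-- **Valuation bookkeeping of the pair, upper-half direction.** If non-zero rationals satisfy
`qK · sW · sV = q · q' · sK` with `sW, sV, sK` positive naturals (the identity `(★)` read in `ℚ`) and
`ord_p sK ≤ ord_p qK` (the upper half over `K`), then `ord_p sW + ord_p sV ≤ ord_p q + ord_p q'`. [folklore] -/
theorem padicValRat_natCast_add_le_of_mul_eq (p : ℕ) [Fact p.Prime] {qK q q' : ℚ} {sW sV sK : ℕ}
    (hq : q ≠ 0) (hq' : q' ≠ 0) (hsW : sW ≠ 0) (hsV : sV ≠ 0) (hsK : sK ≠ 0)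
    (hQ : qK * sW * sV = q * q' * sK) (hle : (padicValNat p sK : ℤ) ≤ padicValRat p qK) :
    (padicValNat p sW : ℤ) + (padicValNat p sV : ℤ) ≤ padicValRat p q + padicValRat p q' := by
  have hsWq : (sW : ℚ) ≠ 0 := by exact_mod_cast hsW
  have hsVq : (sV : ℚ) ≠ 0 := by exact_mod_cast hsV
  have hsKq : (sK : ℚ) ≠ 0 := by exact_mod_cast hsK
  have hqK : qK ≠ 0 := by
    intro h0
    rw [h0, zero_mul, zero_mul] at hQ
    exact mul_ne_zero (mul_ne_zero hq hq') hsKq hQ.symm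
  have hv := congrArg (padicValRat p) hQ
  rw [padicValRat.mul (mul_ne_zero hqK hsWq) hsVq, padicValRat.mul hqK hsWq,
    padicValRat.mul (mul_ne_zero hq hq') hsKq, padicValRat.mul hq hq',
    padicValRat.of_nat, padicValRat.of_nat, padicValRat.of_nat] at hv
  linarith

/-! ## (i) The crux from the published inputs and the upper half over `K` -/

/-- **`RamifiedPairUpperBound` from the displayed published inputs and the UPPER half of `BSD₃` over the
3-ramified field.** GIVEN Gross–Zagier–Kolyvagin (`hGZK`, the route's `PublishedInputGZK`), modularity
(`hE` entire continuation of `L(E,s)`, `hmodP` modular parametrisations), Gross–Zagier 1986 Thm. I.(7.3)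
(`hGZ`), Milne 1972 Thm. 1 / Dokchitser–Dokchitser 2010 §2.1 on an arbitrary `K`-model (`hMilne`), and the
ONE over-`K` statement `hKU` («UpperHalfOverK»: for every `(W, V, d)` as in the crux and every quadratic
field `K = ℚ(θ)`, `θ² = d`, with `Ш(W_K)` finite, `#Ш_an(W_K/K) = analyticSha (W.baseChange K)` is a
rational `q` with `ord₃ #Ш(W_K/K) ≤ ord₃ q` — the 3-exact Kolyvagin / CM-points-on-`X_U` shadow over the
3-RAMIFIED `K`, NOT in print, NOT proved here), the route crux `RamifiedPairUpperBound` holds. Proof: the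
module docstring's bookkeeping and `padicValRat_natCast_add_le_of_mul_eq`.
[cite: Milne1972ArithmeticAV, §1 Thm. 1]
[cite: DokchitserDokchitserAnnals2010, §2.1: statement 2.1, Notation, proof of Thm. 2.3]
[cite: GrossZagier1986, Thm. I.(7.3)] [cite: Miller2011LMS, §1 and Def. 1.1 (arXiv:1010.2431 p. 3)] -/
theorem ramifiedPairUpperBound_of_upperHalfOverK
    (hGZK : rank_eq_analyticRank_of_analyticRank_le_one) (hE : hasEntireLFunction_rat)
    (hmodP : nonempty_modularParametrizationData) (hGZ : GrossZagier1986_thm_I_7_3)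
    (hMilne : Milne1972.bsdQuotient_baseChange_quadratic_anyModel)
    (hKU : ∀ (W : WeierstrassCurve ℚ) [W.IsElliptic] [W.IsGloballyMinimal]
      (V : WeierstrassCurve ℚ) [V.IsElliptic] [V.IsGloballyMinimal] (d : ℤ),
      ¬ W.HasCM → Addv W 3 → Summit.BirchSwinnertonDyer.Rank1Residual.Additive.SubGss W 3 →
      d < 0 → padicValInt 3 d = 1 → Squarefree d →
      (∃ C : WeierstrassCurve.VariableChange ℚ, C • W.quadraticTwist (d : ℚ) = V) →
      GoodSS V 3 → W.analyticRank + V.analyticRank = 1 →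
      ∀ (K : Type) [Field K] [NumberField K] (θ : K), Module.finrank ℚ K = 2 → θ ^ 2 = (d : K) →
        (W.baseChange K).ShaFinite →
        ∃ q : ℚ, analyticSha (W.baseChange K) = (q : ℂ) ∧
          (padicValNat 3 (W.baseChange K).shaOrder : ℤ) ≤ padicValRat 3 q) :
    Summit.BirchSwinnertonDyer.BirchSwinnertonDyer.Theses.RamifiedHeegnerPair.RamifiedPairUpperBound := by
  intro W _ _ V _ _ d hCM hadd hsub hd hv hsq hC hss hsum
  -- analytic ranks `≤ 1` and finiteness of `Ш` over `ℚ` (Gross–Zagier–Kolyvagin)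
  have hrW : W.analyticRank ≤ 1 := by omega
  have hrV : V.analyticRank ≤ 1 := by omega
  have hWfin : W.ShaFinite := (hGZK W hrW).2
  have hVfin : V.ShaFinite := (hGZK V hrV).2
  -- the field `K = ℚ(√d)` (`d` is not a square: `ord₃ d = 1`)
  obtain ⟨K, _, _, θ, h2, hθ, hθK⟩ := SolventPairLowerBound.exists_quadraticField_sq_eq_intCast
    (SolventPairLowerBound.not_isSquare_ratCast_of_padicValInt_eq_one 3 hv)
  -- `V` is a model of the twist by the discriminant `d_K = d q²`
  have hVd : ∃ C : WeierstrassCurve.VariableChange ℚ,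
      C • W.quadraticTwist (NumberField.discr K : ℚ) = V :=
    SolventPairLowerBound.exists_variableChange_quadraticTwist_discr h2 hθ hθK W V hC
  -- the `K`-model `W_K`
  haveI : (W.baseChange K).IsElliptic := by
    rw [WeierstrassCurve.baseChange]; infer_instance
  have hV' : ∃ C : WeierstrassCurve.VariableChange K, C • W.baseChange K = W.baseChange K :=
    ⟨1, one_smul _ _⟩
  -- Milne: `Ш(W_K)` finite and the Weil-restriction identity on the model `W_K`
  obtain ⟨hKfin, hWR⟩ := hMilne W K h2 V hVd (W.baseChange K) hV' hWfin hVfin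
  -- (★): `#Ш_an(W_K)·#Ш(W)·#Ш(V) = #Ш_an(W)·#Ш_an(V)·#Ш(W_K)` in `ℂ`
  have hstar := Summit.BirchSwinnertonDyer.Rank1Residual.AdditivePotMult.shaAnOverC_mul_eq
    W K V (W.baseChange K) hE h2 hVd hV' hWfin hVfin hWR
  -- rationality over `ℚ`
  obtain ⟨q, hq⟩ := RamifiedPairLowerBound.exists_rat_shaAn_eq_of_analyticRank_le_one hmodP hGZ hGZK W hrW
  obtain ⟨q', hq'⟩ := RamifiedPairLowerBound.exists_rat_shaAn_eq_of_analyticRank_le_one hmodP hGZ hGZK V hrV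
  -- the upper half over `K`
  obtain ⟨qK, hqK, hle⟩ := hKU W V d hCM hadd hsub hd hv hsq hC hss hsum K θ h2 hθ hKfin
  have hqK' : Summit.BirchSwinnertonDyer.Rank1Residual.AdditivePotMult.shaAnOverC (W.baseChange K) =
      (qK : ℂ) := hqK
  refine ⟨q, q', hq, hq', ?_⟩
  -- non-vanishing
  have hsW : W.shaOrder ≠ 0 := (W.shaOrder_pos hWfin).ne'
  have hsV : V.shaOrder ≠ 0 := (V.shaOrder_pos hVfin).ne'
  have hsK : (W.baseChange K).shaOrder ≠ 0 := ((W.baseChange K).shaOrder_pos hKfin).ne'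
  have hq0 : q ≠ 0 := by
    intro h0
    apply Summit.BirchSwinnertonDyer.Rank1Residual.AdditivePotMult.shaAn_ne_zero W hE
    rw [hq, h0, Rat.cast_zero]
  have hq0' : q' ≠ 0 := by
    intro h0
    apply Summit.BirchSwinnertonDyer.Rank1Residual.AdditivePotMult.shaAn_ne_zero V hE
    rw [hq', h0, Rat.cast_zero]
  -- (★) in `ℚ`
  have hQ : qK * W.shaOrder * V.shaOrder = q * q' * (W.baseChange K).shaOrder := by
    have h : ((qK * W.shaOrder * V.shaOrder : ℚ) : ℂ) =
        ((q * q' * (W.baseChange K).shaOrder : ℚ) : ℂ) := by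
      push_cast
      rw [← hq, ← hq', ← hqK']
      exact hstar
    exact_mod_cast h
  exact padicValRat_natCast_add_le_of_mul_eq 3 hq0 hq0' hsW hsV hsK hQ hle

/-! ## (i′) The converse: the upper half over `K` from the crux (the reshape is lossless) -/

/-- **Valuation bookkeeping of the pair, converse direction.** If non-zero rationals satisfy
`qK · sW · sV = q · q' · sK` with `sW, sV, sK` positive naturals and `ord_p sW + ord_p sV ≤ ord_p q + ord_p q'`
(the pair inequality over `ℚ`, upper-half direction), then `ord_p sK ≤ ord_p qK` (the upper half over `K`).
[folklore] -/
theorem padicValRat_natCast_le_of_mul_eq (p : ℕ) [Fact p.Prime] {qK q q' : ℚ} {sW sV sK : ℕ}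
    (hq : q ≠ 0) (hq' : q' ≠ 0) (hsW : sW ≠ 0) (hsV : sV ≠ 0) (hsK : sK ≠ 0)
    (hQ : qK * sW * sV = q * q' * sK)
    (hle : (padicValNat p sW : ℤ) + (padicValNat p sV : ℤ) ≤ padicValRat p q + padicValRat p q') :
    (padicValNat p sK : ℤ) ≤ padicValRat p qK := by
  have hsWq : (sW : ℚ) ≠ 0 := by exact_mod_cast hsW
  have hsVq : (sV : ℚ) ≠ 0 := by exact_mod_cast hsV
  have hsKq : (sK : ℚ) ≠ 0 := by exact_mod_cast hsK
  have hqK : qK ≠ 0 := by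
    intro h0
    rw [h0, zero_mul, zero_mul] at hQ
    exact mul_ne_zero (mul_ne_zero hq hq') hsKq hQ.symm
  have hv := congrArg (padicValRat p) hQ
  rw [padicValRat.mul (mul_ne_zero hqK hsWq) hsVq, padicValRat.mul hqK hsWq,
    padicValRat.mul (mul_ne_zero hq hq') hsKq, padicValRat.mul hq hq',
    padicValRat.of_nat, padicValRat.of_nat, padicValRat.of_nat] at hv
  linarith

/-- **The upper half over `K` from `RamifiedPairUpperBound` (the reduction is lossless).** GIVEN three of the
displayed published inputs (`hGZK`, `hE`, `hMilne`; rationality over `ℚ` now comes from the crux itself), the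
route crux `RamifiedPairUpperBound` IMPLIES the over-`K` statement «UpperHalfOverK» of
`ramifiedPairUpperBound_of_upperHalfOverK` — so, modulo the published inputs, the registered load-bearing stub
`stub_upperHalfOverK` of the line `birth` (skeleton v3) is EQUIVALENT to the crux, not a strengthening of it: for
`(W, V, d)` as in the crux and any quadratic `K = ℚ(θ)`, `θ² = d`, with `Ш(W_K)` finite, `analyticSha (W.baseChange K)`
is a rational `qK` with `ord₃ #Ш(W_K) ≤ ord₃ qK`. Proof: the bookkeeping of (i) read backwards — `θ ∉ ℚ` since
`ord₃ d = 1`, `V ≅ W^{(d_K)}`, Milne's identity, `#Ш_an(W_K) = q q' #Ш(W_K)/(#Ш(W) #Ш(V))`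
(`AdditivePotMult.exists_shaAnOverC_eq_of_rat`; `analyticSha = shaAnOverC` by `rfl`), and
`padicValRat_natCast_le_of_mul_eq`. The X1 twin is `RamifiedPairLowerBound.lowerHalfOverK_of_ramifiedPairLowerBound`.
BSD is not proved by any of this. [cite: Milne1972ArithmeticAV, §1 Thm. 1]
[cite: DokchitserDokchitserAnnals2010, §2.1: statement 2.1, Notation, proof of Thm. 2.3]
[cite: Miller2011LMS, §1 and Def. 1.1 (arXiv:1010.2431 p. 3)] -/
theorem upperHalfOverK_of_ramifiedPairUpperBound
    (hGZK : rank_eq_analyticRank_of_analyticRank_le_one) (hE : hasEntireLFunction_rat)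
    (hMilne : Milne1972.bsdQuotient_baseChange_quadratic_anyModel)
    (hX2 : Summit.BirchSwinnertonDyer.BirchSwinnertonDyer.Theses.RamifiedHeegnerPair.RamifiedPairUpperBound) :
    ∀ (W : WeierstrassCurve ℚ) [W.IsElliptic] [W.IsGloballyMinimal]
      (V : WeierstrassCurve ℚ) [V.IsElliptic] [V.IsGloballyMinimal] (d : ℤ),
      ¬ W.HasCM → Addv W 3 → Summit.BirchSwinnertonDyer.Rank1Residual.Additive.SubGss W 3 →
      d < 0 → padicValInt 3 d = 1 → Squarefree d →
      (∃ C : WeierstrassCurve.VariableChange ℚ, C • W.quadraticTwist (d : ℚ) = V) →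
      GoodSS V 3 → W.analyticRank + V.analyticRank = 1 →
      ∀ (K : Type) [Field K] [NumberField K] (θ : K), Module.finrank ℚ K = 2 → θ ^ 2 = (d : K) →
        (W.baseChange K).ShaFinite →
        ∃ q : ℚ, analyticSha (W.baseChange K) = (q : ℂ) ∧
          (padicValNat 3 (W.baseChange K).shaOrder : ℤ) ≤ padicValRat 3 q := by
  intro W _ _ V _ _ d hCM hadd hsub hd hv hsq hC hss hsum K _ _ θ h2 hθ hKfin
  -- analytic ranks `≤ 1` and finiteness of `Ш` over `ℚ` (Gross–Zagier–Kolyvagin)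
  have hrW : W.analyticRank ≤ 1 := by omega
  have hrV : V.analyticRank ≤ 1 := by omega
  have hWfin : W.ShaFinite := (hGZK W hrW).2
  have hVfin : V.ShaFinite := (hGZK V hrV).2
  -- `θ ∉ ℚ`: `d` is not a rational square (`ord₃ d = 1`)
  have hθK : θ ∉ Set.range (algebraMap ℚ K) := by
    rintro ⟨r, hr⟩
    apply SolventPairLowerBound.not_isSquare_ratCast_of_padicValInt_eq_one 3 hv
    refine ⟨r, ?_⟩
    apply (algebraMap ℚ K).injective
    rw [map_mul, hr, ← sq, hθ, map_intCast]
  -- `V` is a model of the twist by the discriminant `d_K = d q²`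
  have hVd : ∃ C : WeierstrassCurve.VariableChange ℚ,
      C • W.quadraticTwist (NumberField.discr K : ℚ) = V :=
    SolventPairLowerBound.exists_variableChange_quadraticTwist_discr h2 hθ hθK W V hC
  -- the `K`-model `W_K`
  haveI : (W.baseChange K).IsElliptic := by
    rw [WeierstrassCurve.baseChange]; infer_instance
  have hV' : ∃ C : WeierstrassCurve.VariableChange K, C • W.baseChange K = W.baseChange K :=
    ⟨1, one_smul _ _⟩
  -- Milne: the Weil-restriction identity on the model `W_K`
  obtain ⟨-, hWR⟩ := hMilne W K h2 V hVd (W.baseChange K) hV' hWfin hVfin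
  -- rationality over `ℚ` and the crux's pair inequality
  obtain ⟨q, q', hq, hq', hle⟩ := hX2 W V d hCM hadd hsub hd hv hsq hC hss hsum
  -- `#Ш_an(W_K)` is rational: `q q' #Ш(W_K) / (#Ш(W) #Ш(V))`
  have hqK := Summit.BirchSwinnertonDyer.Rank1Residual.AdditivePotMult.exists_shaAnOverC_eq_of_rat
    W K V (W.baseChange K) hE h2 hVd hV' hWfin hVfin hWR hq hq'
  refine ⟨_, hqK, ?_⟩
  -- non-vanishing
  have hsW : W.shaOrder ≠ 0 := (W.shaOrder_pos hWfin).ne'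
  have hsV : V.shaOrder ≠ 0 := (V.shaOrder_pos hVfin).ne'
  have hsK : (W.baseChange K).shaOrder ≠ 0 := ((W.baseChange K).shaOrder_pos hKfin).ne'
  have hq0 : q ≠ 0 := by
    intro h0
    apply Summit.BirchSwinnertonDyer.Rank1Residual.AdditivePotMult.shaAn_ne_zero W hE
    rw [hq, h0, Rat.cast_zero]
  have hq0' : q' ≠ 0 := by
    intro h0
    apply Summit.BirchSwinnertonDyer.Rank1Residual.AdditivePotMult.shaAn_ne_zero V hE
    rw [hq', h0, Rat.cast_zero]
  -- (★) in `ℚ` for the rational value of `#Ш_an(W_K)`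
  have hQ : (q * q' * (W.baseChange K).shaOrder / (W.shaOrder * V.shaOrder)) * W.shaOrder * V.shaOrder =
      q * q' * (W.baseChange K).shaOrder := by
    have hsWq : (W.shaOrder : ℚ) ≠ 0 := by exact_mod_cast hsW
    have hsVq : (V.shaOrder : ℚ) ≠ 0 := by exact_mod_cast hsV
    field_simp
  exact padicValRat_natCast_le_of_mul_eq 3 hq0 hq0' hsW hsV hsK hQ hle

/-! ## (ii) The crux from the two members' upper halves over `ℚ` -/

/-- A `ℚ`-model of a quadratic twist of a non-CM curve is non-CM (`j(C • W^{(d)}) = j(W)`;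
`HasCM` depends on `j` only). [cite: SilvermanAEC2009, X.5 Cor. 5.4 and III.1 Prop. 1.4(b)] -/
theorem not_hasCM_of_smul_quadraticTwist_eq {W V : WeierstrassCurve ℚ} [W.IsElliptic] [V.IsElliptic]
    {d : ℚ} (hd : d ≠ 0) {C : WeierstrassCurve.VariableChange ℚ} (hC : C • W.quadraticTwist d = V)
    (hCM : ¬ W.HasCM) : ¬ V.HasCM := by
  haveI : (W.quadraticTwist d).IsElliptic := W.isElliptic_quadraticTwist hd
  subst hC
  have hj : (C • W.quadraticTwist d).j = W.j :=
    ((W.quadraticTwist d).variableChange_j C).trans (W.j_quadraticTwist hd)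
  exact fun h ↦ hCM ((hasCM_iff_of_j_eq hj).mp h)

/-- **`RamifiedPairUpperBound` from the members' Euler-system halves over `ℚ`** (pure bookkeeping, no
published input): if every non-CM globally minimal `W` additive of class `(G) ∧ ss` at `3` with
`r_an(W) ≤ 1` satisfies `Typed.MissingUpperBoundAt W 3` (`ord₃ #Ш(W) ≤ ord₃ #Ш_an(W)`, `#Ш_an` rational),
and likewise every non-CM globally minimal `V` with GOOD supersingular reduction at `3` and `r_an(V) ≤ 1`,
then the pair inequality of the crux holds for every admissible `(W, V, d)` (the twist `V` is non-CM with
`r_an(V) ≤ 1`). [cite: Miller2011LMS, §1 and Def. 1.1 (arXiv:1010.2431 p. 3)] -/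
theorem ramifiedPairUpperBound_of_missingUpperBoundAt
    (hW : ∀ (W : WeierstrassCurve ℚ) [W.IsElliptic] [W.IsGloballyMinimal],
      ¬ W.HasCM → Addv W 3 → Summit.BirchSwinnertonDyer.Rank1Residual.Additive.SubGss W 3 →
      W.analyticRank ≤ 1 → Typed.MissingUpperBoundAt W 3)
    (hV : ∀ (V : WeierstrassCurve ℚ) [V.IsElliptic] [V.IsGloballyMinimal],
      ¬ V.HasCM → GoodSS V 3 → V.analyticRank ≤ 1 → Typed.MissingUpperBoundAt V 3) :
    Summit.BirchSwinnertonDyer.BirchSwinnertonDyer.Theses.RamifiedHeegnerPair.RamifiedPairUpperBound := by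
  intro W _ _ V _ _ d hCM hadd hsub hd _hv _hsq hC hss hsum
  have hrW : W.analyticRank ≤ 1 := by omega
  have hrV : V.analyticRank ≤ 1 := by omega
  obtain ⟨C, hC⟩ := hC
  have hd0 : (d : ℚ) ≠ 0 := by exact_mod_cast hd.ne
  have hCMV : ¬ V.HasCM := not_hasCM_of_smul_quadraticTwist_eq hd0 hC hCM
  obtain ⟨q, hq, hleW⟩ := hW W hCM hadd hsub hrW
  obtain ⟨q', hq', hleV⟩ := hV V hCMV hss hrV
  exact ⟨q, q', hq, hq', by linarith⟩

end Summit.BirchSwinnertonDyer.BirchSwinnertonDyer.Theorems.RamifiedPairUpperBound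

end
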